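import Summits.Schanuel.Schanuel.Theses.RoyCriterion
import Summits.Schanuel.Schanuel.Theses.EclCore
import Literature.Barriers.Schanuel.LargeTranscendenceDegreeThm29Holds
import Literature.Barriers.Schanuel.LargeTranscendenceDegreeTwoTwoProofs

-- `Summit.Schanuel.Schanuel.…` is the mandated layout of this single-problem summit (CONVENTIONS §1).
set_option linter.dupNamespace false

/-!
# Line `GridTwoTwo` — skeleton for crux `SchanuelTwo` (stmt-Schanuel-0069), G4 ladder-down (fwd-ladder-Schanuel-50)

Crux (FIXED, by name): `Summit.Schanuel.Schanuel.Theses.RoyCriterion.SchanuelTwo`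
(= `…Theses.EclCore.SchanuelTwo`, same term) — Schanuel's conjecture in dimension two.

## The ladder (LADDER-SchanuelTwo.md; companion `Lines/GridTwoTwo_special.lean` proves every claim below
except the three stubs)

Grade the crux by the SHAPE `(m,n)` of the exponential grid of the Gel'fond–Schneider method in several
variables (LNM 1752 Ch. 14, Conjecture 2.3 / Theorem 2.9, `t₂`-clauses): for `ℚ`-free `x : Fin m → ℂ`,
`y : Fin n → ℂ` let `Rung m n := 2 ≤ trdeg_ℚ ℚ(x, y, e^{xᵢyⱼ})`
(`Literature.Barriers.Schanuel.gridField₂ x y = adjoin ℚ (range x ∪ range y ∪ range fun p => cexp (x p.1 * y p.2))`).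
* TOP `(1,2)`: `Rung 1 2 ↔ SchanuelTwo ↔ Rung 2 1` (proved: `x = (1)` one way, the free pair
  `(x₀y₀, x₀y₁)` the other).
* FLOOR (PROVED in tree): every cell with `m + n < mn` — `(3,2)`, `(2,3)`, … —
  `Literature.Barriers.Schanuel.two_le_trdeg_gridField₂` (= LNM 1752 Ch. 14 Thm 2.9 `t₂`, Laurent Table 1 (iv),
  Waldschmidt 1981); and, inside the `(2,2)` cell, the sub-rung "two exponentials of one row algebraic" =
  Brownawell–Waldschmidt (`Literature.Barriers.Schanuel.smallTrdeg_thm_2_9_two_two_holds`, tree proof `BWMain`).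
* NEXT RUNG `(2,2)` (OPEN; = Waldschmidt's Conjecture 2.3, `t₂`-clause, at `d = ℓ = 2`, i.e. exactly the first
  grid shape where the Gel'fond–Brownawell–Waldschmidt numerology `mn > m + n` fails): `stub_oneAlgExp`
  (one algebraic exponential: B–W minus one hypothesis; floor = B–W) and `stub_allTranscExp` (all four
  exponentials transcendental; floor = the `(3,2)` theorem), recombined by the proved `grid_two_two_of_cases`.
* GAP (last rung, crux-hard, NO why-easier claimed — do not staff before the two rungs close): `stub_descent :
  Rung 2 2 → Rung 1 2`.
Composition `SchanuelTwo_of` is kernel-checked; sorries live only in the three `stub_*`.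

## Disproof.lean honoured
`schanuelTwo_false_without_linIndep` / `schanuelTwo_false_with_nonzero_injective`: every stub keeps BOTH
`LinearIndependent ℚ x` and `LinearIndependent ℚ y` (for `m = 1` this is `x₀ ≠ 0`; dropping either makes the
cell false: `x = (1, 2)` gives `ℚ(y, e^y, e^{2y})`). `not_schanuelTwoExpPart` / `not_schanuelTwoBasePart`:
the stubs bound the trdeg of the FULL grid field `ℚ(x, y, e^{xy})`, never of the exponentials or the bases
alone. `not_schanuelTwoThree` (tightness): the bound is `2`, never `3`. `schanuelTwo_of_isAlgebraic`
(both `e^{yⱼ}` algebraic ⇒ crux by Baker) is the `m = 1` shadow of the B–W floor used here.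

## Dead lines avoided
`Lines/CardA_BW` (sector atlas) died at `stub_rest ≡ crux` (CardA_BW-dead.md): its stubs were SECTORS of the
crux's own `x`-space whose complement was crux-hard by a meta-lemma. Here no stub quantifies over the crux's
`x : Fin 2 → ℂ` with a side condition: the two rung stubs are UNIFORM statements about a DIFFERENT, larger
configuration space (2 × 2 grids), each strictly below the crux (crux ⇒ stub proved in `_special`), each with a
proved neighbour one parameter step away; the crux-hard remainder is isolated and declared (`stub_descent`).
`Lines/CardB_Scale` (CM level-set period scale) is a different mechanism (modular/CM points), untouched.
-/

noncomputable section

open Complex IntermediateField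
open Literature.Barriers.Schanuel (gridField₂ trdeg_mono)

namespace Summit.Schanuel.Schanuel.Cruxes.SchanuelTwo.GridTwoTwo

/-! ## §0 Glue (sorry-free) -/

/-- Permuting the indices of `x` and of `y` does not change `ℚ(x, y, e^{xᵢyⱼ})`. -/
theorem gridField₂_comp_equiv {m n : ℕ} (x : Fin m → ℂ) (y : Fin n → ℂ)
    (σ : Equiv.Perm (Fin m)) (τ : Equiv.Perm (Fin n)) :
    gridField₂ (x ∘ σ) (y ∘ τ) = gridField₂ x y := by
  show adjoin ℚ _ = adjoin ℚ _
  congr 1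
  rw [σ.surjective.range_comp, τ.surjective.range_comp]
  congr 1
  have : (fun p : Fin m × Fin n => cexp ((x ∘ σ) p.1 * (y ∘ τ) p.2)) =
      (fun p : Fin m × Fin n => cexp (x p.1 * y p.2)) ∘ (Prod.map σ τ) := by
    funext p; rfl
  rw [this, (σ.surjective.prodMap τ.surjective).range_comp]

/-- **Top of the ladder, downward**: the `(1,2)` cell gives the crux (take `x = (1)`:
`ℚ(1, y, e^{1·yⱼ}) ⊆ ℚ(y, e^y)`). -/
theorem schanuelTwo_of_grid_one_two
    (h : ∀ (x : Fin 1 → ℂ) (y : Fin 2 → ℂ), LinearIndependent ℚ x → LinearIndependent ℚ y →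
      (2 : Cardinal) ≤ Algebra.trdeg ℚ (gridField₂ x y)) :
    Summit.Schanuel.Schanuel.Theses.RoyCriterion.SchanuelTwo := by
  intro y hy
  have h1 : LinearIndependent ℚ (fun _ : Fin 1 => (1 : ℂ)) :=
    linearIndependent_unique_iff.mpr one_ne_zero
  refine (h (fun _ => 1) y h1 hy).trans (trdeg_mono ?_)
  change adjoin ℚ _ ≤ _
  rw [adjoin_le_iff]
  rintro w ((⟨i, rfl⟩ | ⟨j, rfl⟩) | ⟨p, rfl⟩)
  · exact (adjoin ℚ _).one_mem
  · exact subset_adjoin ℚ _ (Or.inl ⟨j, rfl⟩)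
  · show cexp (1 * y p.2) ∈ adjoin ℚ (Set.range y ∪ Set.range (cexp ∘ y))
    rw [one_mul]
    exact subset_adjoin ℚ _ (Or.inr ⟨p.2, rfl⟩)

/-- **The next rung from its two regimes**: some `e^{xᵢyⱼ}` algebraic (moved to position `(0,0)` by
permuting indices) or all four transcendental. -/
theorem grid_two_two_of_cases
    (h1 : ∀ (x y : Fin 2 → ℂ), LinearIndependent ℚ x → LinearIndependent ℚ y →
      IsAlgebraic ℚ (cexp (x 0 * y 0)) → (2 : Cardinal) ≤ Algebra.trdeg ℚ (gridField₂ x y))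
    (h0 : ∀ (x y : Fin 2 → ℂ), LinearIndependent ℚ x → LinearIndependent ℚ y →
      (∀ i j, Transcendental ℚ (cexp (x i * y j))) → (2 : Cardinal) ≤ Algebra.trdeg ℚ (gridField₂ x y)) :
    ∀ (x y : Fin 2 → ℂ), LinearIndependent ℚ x → LinearIndependent ℚ y →
      (2 : Cardinal) ≤ Algebra.trdeg ℚ (gridField₂ x y) := by
  intro x y hx hy
  by_cases H : ∃ i j, IsAlgebraic ℚ (cexp (x i * y j))
  · obtain ⟨i, j, hij⟩ := H
    have hx' : LinearIndependent ℚ (x ∘ Equiv.swap 0 i) := hx.comp _ (Equiv.injective _)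
    have hy' : LinearIndependent ℚ (y ∘ Equiv.swap 0 j) := hy.comp _ (Equiv.injective _)
    have key := h1 (x ∘ Equiv.swap 0 i) (y ∘ Equiv.swap 0 j) hx' hy'
      (by simpa [Equiv.swap_apply_left] using hij)
    exact key.trans (trdeg_mono (gridField₂_comp_equiv x y (Equiv.swap 0 i) (Equiv.swap 0 j)).le)
  · simp only [not_exists] at H
    exact h0 x y hx hy H

/-! ## §1 Registered stubs (the rungs; sorries live ONLY here) -/

/-- **stub_oneAlgExp — RUNG `(2,2)`, regime "one algebraic exponential"** (= `RungBW 1`; the B–W theorem with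
ONE of its two algebraicity hypotheses removed). For `ℚ`-free `x, y : Fin 2 → ℂ` with `e^{x₀y₀} ∈ ℚ̄`:
`trdeg_ℚ ℚ(x, y, e^{x₀y₀}, e^{x₀y₁}, e^{x₁y₀}, e^{x₁y₁}) ≥ 2`.
Floor one step down: `Literature.Barriers.Schanuel.smallTrdeg_thm_2_9_two_two_holds` (both `e^{x₀y₀}, e^{x₀y₁}`
algebraic; tree proof `BrownawellWaldschmidt.brownawell_waldschmidt`). Instances: Chudnovsky 1984 Problem 5(a)
(`x = (1, β)`, `y = (log α, β log α)`, `β` quadratic: `log α ⊥ α^β`, open); `x = (1, i)`, `y = (iπ, −π)`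
(`π ⊥ e^π`, Nesterenko 1996 — true, by a modular engine). Why it might fail to close: the B–W auxiliary
polynomial `P(z, e^{x₀y₀ z}, e^{x₀y₁ z})` needs both values algebraic so that powers do not raise the
`θ`-degree (`BWValues`); with one transcendental value the Siegel count `4·#eq ≤ #unknowns` breaks — a new
zero/multiplicity input at the boundary `mn = m + n` is required (LNM 1752 Ch. 14 §2.2; Chudnovsky 1984 Ch. 1 §1). -/
theorem stub_oneAlgExp :
    ∀ (x y : Fin 2 → ℂ), LinearIndependent ℚ x → LinearIndependent ℚ y →
      IsAlgebraic ℚ (cexp (x 0 * y 0)) →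
      (2 : Cardinal) ≤ Algebra.trdeg ℚ (gridField₂ x y) := by
  sorry

/-- **stub_allTranscExp — RUNG `(2,2)`, regime "all four exponentials transcendental"**: for `ℚ`-free
`x, y : Fin 2 → ℂ` with every `e^{xᵢyⱼ} ∉ ℚ̄`: `trdeg_ℚ ℚ(x, y, e^{xᵢyⱼ}) ≥ 2`.
Floor one step down: the `(3,2)` cell `Literature.Barriers.Schanuel.two_le_trdeg_gridField₂` (`m + n < mn`,
LNM 1752 Thm 2.9 `t₂`). Together with `stub_oneAlgExp` this is exactly Waldschmidt's Conjecture 2.3 (`t₂`) at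
`d = ℓ = 2` (`Literature.Barriers.Schanuel.WaldschmidtConjecture_2_3`, third clause). Instances: `x = (1, e)`,
`y = (1, e)` (`#{e, e^e, e^{e²}} ≥ 2` a.i., open); `x = y = (1, log 2)` (`log 2 ⊥ 2^{log 2}`, open).
Why it might fail to close: the one-variable Gel'fond method with `L = 2·2` functions `e^{xᵢ z}` evaluated on
`ℤy₁ + ℤy₂` sits exactly at `mn = m + n`, where Tijdeman's zero estimate leaves no room (Chudnovsky 1984
Thm 3: `|S|/(M+N) > d` needs `d < 2`); every known proof of a `(2,2)` statement imports extra structure. -/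
theorem stub_allTranscExp :
    ∀ (x y : Fin 2 → ℂ), LinearIndependent ℚ x → LinearIndependent ℚ y →
      (∀ i j, Transcendental ℚ (cexp (x i * y j))) →
      (2 : Cardinal) ≤ Algebra.trdeg ℚ (gridField₂ x y) := by
  sorry

/-- **stub_descent — the GAP (last rung → top)**: the `(2,2)` cell implies the `(1,2)` cell (≡ the crux).
Informal content: given `ℚ`-free `(y₁, y₂)`, one must produce a second row `t·(y₁, y₂)`, `t ∉ ℚ`, whose three new
numbers `t, e^{ty₁}, e^{ty₂}` add NO transcendence degree over `ℚ(y, e^{y})` unless that field is already big —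
an auxiliary-point / specialisation statement for which no tool is named. HONEST LAST RUNG (G4 brief: "the gap
itself"), predicted tier C on its own, crux-hard; do not staff before `stub_oneAlgExp` / `stub_allTranscExp`. -/
theorem stub_descent :
    (∀ (x y : Fin 2 → ℂ), LinearIndependent ℚ x → LinearIndependent ℚ y →
      (2 : Cardinal) ≤ Algebra.trdeg ℚ (gridField₂ x y)) →
    ∀ (x : Fin 1 → ℂ) (y : Fin 2 → ℂ), LinearIndependent ℚ x → LinearIndependent ℚ y →
      (2 : Cardinal) ≤ Algebra.trdeg ℚ (gridField₂ x y) := by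
  sorry

/-! ## §2 Composition (kernel-checked; concludes the crux BY NAME) -/

/-- **The line concludes the crux**: rung `(2,2)` (two regimes) → gap → top `(1,2)` = `SchanuelTwo`. -/
theorem SchanuelTwo_of : Summit.Schanuel.Schanuel.Theses.RoyCriterion.SchanuelTwo :=
  schanuelTwo_of_grid_one_two (stub_descent (grid_two_two_of_cases stub_oneAlgExp stub_allTranscExp))

/-- Same term, EclCore copy of the crux decl. -/
theorem SchanuelTwo_proof : Summit.Schanuel.Schanuel.Theses.EclCore.SchanuelTwo :=
  SchanuelTwo_of

end Summit.Schanuel.Schanuel.Cruxes.SchanuelTwo.GridTwoTwo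

end
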